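import Mathlib
import Summits.MatrixMultiplication.MatrixMultiplication.Theses.SnSubsetDichotomy
import Literature.RepresentationTheory.FiniteGroups.VershikKerovMaxDegree
import Summits.MatrixMultiplication.MatrixMultiplication.Theorems.HyperoctahedralThreshold.Negative.SubgroupPivotSieve

/-!
# Crux `JuntaBranch` (stmt-MatrixMultiplication-8304), round 2, ideator 4 — checkable statements

Statements only (no `sorry`): the two provable-now lemmas of the round-2 memo
`Negative-notes/round2-ideator4.md`, and the two structural consequences used there.

* `TestFunctionSieve` — the subgroup-pivot sieve of
  `Theorems/HyperoctahedralThreshold/Negative/SubgroupPivotSieve.lean` (`sieve`, subgroup `H`)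
  generalised to an ARBITRARY test function `φ ∈ ℂ[G]` supported on the quotient set `Q(S)` with
  `φ(1) ≠ 0`: the `|T||U|` pivots `δ_{t⁻¹} * φ * δ_{u}` are linearly independent (TPP makes their
  values at the points `t'⁻¹u` an identity matrix times `φ 1`) and lie in the span of the two-sided
  translates of `φ` (= the two-sided ideal of `φ`), so `|T||U| ≤ dim_ℂ (ℂ[G] φ ℂ[G])`.
* `TwoSidedIdealDimBound` — `dim (ℂ[G] φ ℂ[G]) ≤ d_max(G) · rank (x ↦ x * φ)` (Wedderburn: the ideal
  is the sum of the blocks where `φ̂ ≠ 0`, of dimension `Σ dᵢ² ≤ d_max Σ dᵢ ≤ d_max · rank`).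
* `NoBigSubgroupInQuotient` — consequence in `S_n` with Vershik–Kerov (`φ = 1_H`, `H ≤ Q(S)`):
  in a TPP triple with `|S||T||U| ≥ (n!)^{3/2} e^{-c√n}`, `c + ε < c₂ = vkUpperConst`, no member's
  quotient set contains a subgroup of order `> |S|·e^{-(c₂-c-ε)√n}` (no "conceded coset").
* `WindowRegularity ε c` and `PartialSliceNecessity` — JB ⇒ WindowRegularity: slicing a member to
  its `⌊n^{1/2-ε}/2⌋` heaviest targets of one source costs only the factor `4 n^{1/2+ε}` and
  creates an `ε`-super-neutral level-1 bump, so `JuntaBranch ε c` forces the normalised extremal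
  function not to drop by more than `4n^{1/2+ε}e^{-(c+1)}` across the window `[n-√n, n)` at every
  `Large` level (sharpens the sliced shadow `juntaBranch_imp_slicedShadow`, factor `n`).
-/

set_option linter.dupNamespace false

namespace Summit.MatrixMultiplication.MatrixMultiplication.Cruxes.JuntaBranch.Ideator4

open Literature.Combinatorics.Additive Literature.RepresentationTheory.FiniteGroups
open Summit.MatrixMultiplication.MatrixMultiplication.Theses.SnSubsetDichotomy

/-- The (right) quotient set `Q(S) = {s s'⁻¹}` of Cohn–Umans. -/
def quotientSet {G : Type} [Group G] [DecidableEq G] (S : Finset G) : Finset G :=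
  Finset.image₂ (fun s s' => s * s'⁻¹) S S

/-- **Test-function pivot sieve** (memo §6, lemma L2; provable now along the lines of the tree's
`SubgroupPivotSieve.sieve`): for a TPP triple `(S,T,U)` and any `φ ∈ ℂ[G]` supported on `Q(S)`
with `φ 1 ≠ 0`, `|T|·|U| ≤ dim_ℂ span{δ_a φ δ_b : a, b ∈ G}`. -/
def TestFunctionSieve : Prop :=
  ∀ (G : Type) [Group G] [Fintype G] [DecidableEq G] (S T U : Finset G),
    TripleProductProperty S T U →
    ∀ φ : MonoidAlgebra ℂ G, (∀ g : G, φ.coeff g ≠ 0 → g ∈ quotientSet S) → φ.coeff 1 ≠ 0 →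
      T.card * U.card ≤ Module.finrank ℂ (Submodule.span ℂ
        (Set.range (fun p : G × G =>
          MonoidAlgebra.single p.1 (1 : ℂ) * φ * MonoidAlgebra.single p.2 (1 : ℂ))))

/-- **Dimension of the two-sided ideal** (memo §6): `dim (ℂ[G] φ ℂ[G]) ≤ d_max(G) · rank (· * φ)`. -/
def TwoSidedIdealDimBound : Prop :=
  ∀ (G : Type) [Group G] [Fintype G] [DecidableEq G] (φ : MonoidAlgebra ℂ G),
    Module.finrank ℂ (Submodule.span ℂ
        (Set.range (fun p : G × G =>
          MonoidAlgebra.single p.1 (1 : ℂ) * φ * MonoidAlgebra.single p.2 (1 : ℂ)))) ≤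
      maxCharDegree G * Module.finrank ℂ (LinearMap.range (LinearMap.mulRight ℂ φ))

/-- **No big subgroup in a quotient set** (memo §7; follows from the two statements above with
`φ = 1_H`, `rank (· * 1_H) ≤ [G:H]`, and `VershikKerov1985_maxCharDegree_holds`): for
`c + ε < c₂` and `n` large, a TPP triple of `S_n` at slack `e^{-c√n}` has no member whose
quotient set contains a subgroup of order `> |S| e^{-(c₂-c-ε)√n}`. -/
def NoBigSubgroupInQuotient : Prop :=
  ∀ c ε : ℝ, 0 < c → 0 < ε → c + ε < vkUpperConst → ∃ n₀ : ℕ, ∀ n ≥ n₀,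
    ∀ S T U : Finset (Equiv.Perm (Fin n)), TripleProductProperty S T U →
      (n.factorial : ℝ) ^ ((3 : ℝ) / 2) * Real.exp (-(c * Real.sqrt (n : ℝ))) ≤
        ((S.card * T.card * U.card : ℕ) : ℝ) →
      ∀ H : Subgroup (Equiv.Perm (Fin n)), (∀ h ∈ H, h ∈ quotientSet S) →
        (Nat.card H : ℝ) ≤ (S.card : ℝ) * Real.exp (-((vkUpperConst - c - ε) * Real.sqrt (n : ℝ)))

/-- **Window regularity of the extremal function** forced by JB (memo §4): at every level where a
TPP triple of volume `≥ 4 n^{1/2+ε} (n!)^{3/2} e^{-c√n}` exists, some level of the window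
`[n-√n, n)` carries a TPP triple beating it by `e^{c+1}/(4 n^{1/2+ε})` in normalised volume. -/
def WindowRegularity (ε c : ℝ) : Prop :=
  ∃ n₀ : ℕ, ∀ n ≥ n₀, ∀ S T U : Finset (Equiv.Perm (Fin n)), TripleProductProperty S T U →
    4 * (n : ℝ) ^ (1 / 2 + ε) * ((n.factorial : ℝ) ^ ((3 : ℝ) / 2) *
        Real.exp (-(c * Real.sqrt (n : ℝ)))) ≤ ((S.card * T.card * U.card : ℕ) : ℝ) →
    ∃ n' : ℕ, (n : ℝ) - Real.sqrt (n : ℝ) ≤ (n' : ℝ) ∧ n' < n ∧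
      ∃ S' T' U' : Finset (Equiv.Perm (Fin n')), TripleProductProperty S' T' U' ∧
        Real.exp (c + 1) * ((S.card * T.card * U.card : ℕ) : ℝ) *
            ((n'.factorial : ℝ) / (n.factorial : ℝ)) ^ ((3 : ℝ) / 2) ≤
          4 * (n : ℝ) ^ (1 / 2 + ε) * ((S'.card * T'.card * U'.card : ℕ) : ℝ)

/-- **Partial-slice necessity** (memo §4, lemma L1; provable now: `TripleProductProperty.mono` +
pigeonhole over the `⌊n^{1/2-ε}/2⌋` heaviest targets of one source + the crux applied to the slice). -/
def PartialSliceNecessity : Prop :=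
  JuntaBranch → ∀ ε : ℝ, 0 < ε → ε < 1 / 2 → ∀ c : ℝ, 0 < c → WindowRegularity ε c

/-! ## Proof of the test-function pivot sieve (lemma L2 of the memo) -/

section SieveProof

open MonoidAlgebra

variable {G : Type} [Group G] [DecidableEq G]

omit [DecidableEq G] in
/-- Coefficients of a two-sided translate: `(δ_a * φ * δ_b)(x) = φ(a⁻¹ x b⁻¹)`. -/
theorem coeff_sandwich (φ : MonoidAlgebra ℂ G) (a b x : G) :
    (single a (1 : ℂ) * φ * single b (1 : ℂ)).coeff x = φ.coeff (a⁻¹ * (x * b⁻¹)) := by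
  rw [coeff_mul_single_apply, coeff_single_mul_apply, one_mul, mul_one]

/-- **TPP ⇒ the pivot values form `φ(1)`·identity.** If `φ` is supported on `Q(S)` then for
`t, t' ∈ T`, `u, u' ∈ U`: `φ(t · t'⁻¹u' · u⁻¹) ≠ 0 → t = t' ∧ u = u'`. -/
theorem pivot_offdiag (S T U : Finset G) (hT : TripleProductProperty S T U)
    (φ : MonoidAlgebra ℂ G) (hsupp : ∀ g : G, φ.coeff g ≠ 0 → g ∈ quotientSet S)
    {t t' u u' : G} (ht : t ∈ T) (ht' : t' ∈ T) (hu : u ∈ U) (hu' : u' ∈ U)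
    (hne : φ.coeff (t⁻¹⁻¹ * (t'⁻¹ * u' * u⁻¹)) ≠ 0) : t = t' ∧ u = u' := by
  have hmem := hsupp _ hne
  simp only [quotientSet, Finset.mem_image₂] at hmem
  obtain ⟨s, hs, s', hs', hss⟩ := hmem
  have key : s' * s⁻¹ * (t * t'⁻¹) * (u' * u⁻¹) = 1 := by
    have h2 : s⁻¹ * (t⁻¹⁻¹ * (t'⁻¹ * u' * u⁻¹)) = s'⁻¹ := by
      rw [← hss]; group
    calc s' * s⁻¹ * (t * t'⁻¹) * (u' * u⁻¹)
        = s' * (s⁻¹ * (t⁻¹⁻¹ * (t'⁻¹ * u' * u⁻¹))) := by group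
      _ = 1 := by rw [h2, mul_inv_cancel]
  have h := hT s' hs' s hs t ht t' ht' u' hu' u hu key
  exact ⟨h.2.1, h.2.2.symm⟩

/-- **Test-function pivot sieve, proved** (memo lemma L2). -/
theorem testFunctionSieve_holds : TestFunctionSieve := by
  intro G _ _ _ S T U hT φ hsupp h1
  classical
  haveI : Module.Finite ℂ (MonoidAlgebra ℂ G) := Module.Finite.of_basis (MonoidAlgebra.basis G ℂ)
  -- the pivot family, indexed by T × U
  let ι := (T ×ˢ U : Finset (G × G))
  let v : ι → MonoidAlgebra ℂ G := fun i => single (i.1.1)⁻¹ (1 : ℂ) * φ * single i.1.2 (1 : ℂ)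
  -- values at the points t'⁻¹ u'
  have hval : ∀ i j : ι, (v i).coeff ((j.1.1)⁻¹ * j.1.2) = if i = j then φ.coeff 1 else 0 := by
    intro i j
    obtain ⟨⟨t, u⟩, hi⟩ := i
    obtain ⟨⟨t', u'⟩, hj⟩ := j
    rw [Finset.mem_product] at hi hj
    simp only [v, coeff_sandwich]
    by_cases h : t = t' ∧ u = u'
    · obtain ⟨rfl, rfl⟩ := h
      rw [if_pos rfl]
      congr 1
      group
    · rw [if_neg]
      · by_contra hne
        exact h (pivot_offdiag S T U hT φ hsupp hi.1 hj.1 hi.2 hj.2 (by simpa [mul_assoc] using hne))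
      · intro heq
        apply h
        have := congrArg Subtype.val heq
        simp only [Prod.mk.injEq] at this
        exact this
  -- linear independence
  have hli : LinearIndependent ℂ v := by
    rw [Fintype.linearIndependent_iff]
    intro g hsum i
    have key := congrArg (fun f : MonoidAlgebra ℂ G => f.coeff ((i.1.1)⁻¹ * i.1.2)) hsum
    simp only [coeff_sum, coeff_smul, Finsupp.coe_finsetSum, Finsupp.coe_smul, Finset.sum_apply,
      Pi.smul_apply, smul_eq_mul, coeff_zero, Finsupp.coe_zero, Pi.zero_apply] at key
    rw [Finset.sum_eq_single i (fun j _ hji => by rw [hval j i, if_neg hji, mul_zero])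
      (fun hi => absurd (Finset.mem_univ i) hi), hval i i, if_pos rfl] at key
    exact (mul_eq_zero.1 key).resolve_right h1
  -- the pivots lie in the span of the two-sided translates
  let W := Submodule.span ℂ (Set.range (fun p : G × G =>
    MonoidAlgebra.single p.1 (1 : ℂ) * φ * MonoidAlgebra.single p.2 (1 : ℂ)))
  have hmem : ∀ i : ι, v i ∈ W := fun i => Submodule.subset_span ⟨((i.1.1)⁻¹, i.1.2), rfl⟩
  let w : ι → W := fun i => ⟨v i, hmem i⟩
  have hw : LinearIndependent ℂ w := by
    apply LinearIndependent.of_comp W.subtype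
    exact hli
  have hcard : Fintype.card ι = T.card * U.card := by
    simp only [ι, Fintype.card_coe, Finset.card_product]
  calc T.card * U.card = Fintype.card ι := hcard.symm
    _ ≤ Module.finrank ℂ W := hw.fintype_card_le_finrank

end SieveProof

/-! ## Proof of the two-sided ideal dimension bound (Wedderburn bookkeeping of the tree's
`SubgroupPivotSieve`, with `1_H` replaced by an arbitrary `φ`) -/

section IdealDim

open MonoidAlgebra
open Summit.MatrixMultiplication.MatrixMultiplication.Theorems.HyperoctahedralThreshold.Negative

/-- **`dim (ℂ[G] φ ℂ[G]) ≤ d_max(G) · rank (· * φ)`, proved.** -/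
theorem twoSidedIdealDimBound_holds : TwoSidedIdealDimBound := by
  intro G _ _ _ φ
  classical
  haveI : Module.Finite ℂ (MonoidAlgebra ℂ G) := Module.Finite.of_basis (MonoidAlgebra.basis G ℂ)
  obtain ⟨r, d, hd, ⟨ψ⟩⟩ := exists_algEquiv_pi_matrix G
  haveI : ∀ i, NeZero (d i) := hd
  set e : BlockAlgebraC d := ψ φ with he
  set W := Submodule.span ℂ (Set.range (fun p : G × G =>
    MonoidAlgebra.single p.1 (1 : ℂ) * φ * MonoidAlgebra.single p.2 (1 : ℂ))) with hW
  -- the translates land in the support subspace of `e`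
  have hle : W.map ψ.toLinearEquiv.toLinearMap ≤
      (Submodule.pi {i | e i = 0} (fun _ => ⊥) : Submodule ℂ (BlockAlgebraC d)) := by
    rw [hW, Submodule.map_span_le]
    rintro _ ⟨p, rfl⟩
    show ψ (single p.1 (1 : ℂ) * φ * single p.2 (1 : ℂ)) ∈ _
    rw [map_mul, map_mul]
    exact sandwich_mem_suppSub e _ _
  have h1 : Module.finrank ℂ W ≤
      Module.finrank ℂ (Submodule.pi {i | e i = 0} (fun _ => ⊥) : Submodule ℂ (BlockAlgebraC d)) := by
    rw [← LinearEquiv.finrank_map_eq ψ.toLinearEquiv W]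
    exact Submodule.finrank_mono hle
  have h2 := finrank_suppSub_le e
  have h3 : ∑ i : {i // e i ≠ 0}, d i.1 ^ 2 ≤ maxCharDegree G * ∑ i : {i // e i ≠ 0}, d i.1 := by
    rw [Finset.mul_sum]
    refine Finset.sum_le_sum fun i _ => ?_
    rw [sq]
    exact Nat.mul_le_mul_right _ (blockDegree_le_maxCharDegree ψ i.1)
  have h4 := sum_le_finrank_range_mulRight e
  have h5 : Module.finrank ℂ (LinearMap.range (LinearMap.mulRight ℂ e)) =
      Module.finrank ℂ (LinearMap.range (LinearMap.mulRight ℂ φ)) := by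
    have hmap : LinearMap.range (LinearMap.mulRight ℂ e) =
        (LinearMap.range (LinearMap.mulRight ℂ φ)).map ψ.toLinearEquiv.toLinearMap := by
      ext y
      simp only [LinearMap.mem_range, LinearMap.mulRight_apply, Submodule.mem_map]
      constructor
      · rintro ⟨x, rfl⟩
        refine ⟨ψ.symm x * φ, ⟨ψ.symm x, rfl⟩, ?_⟩
        simp [he]
      · rintro ⟨z, ⟨x, rfl⟩, rfl⟩
        exact ⟨ψ x, by simp [he]⟩
    rw [hmap, LinearEquiv.finrank_map_eq]
  calc Module.finrank ℂ W
      ≤ Module.finrank ℂ (Submodule.pi {i | e i = 0} (fun _ => ⊥) : Submodule ℂ (BlockAlgebraC d)) := h1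
    _ ≤ ∑ i : {i // e i ≠ 0}, d i.1 ^ 2 := h2
    _ ≤ maxCharDegree G * ∑ i : {i // e i ≠ 0}, d i.1 := h3
    _ ≤ maxCharDegree G * Module.finrank ℂ (LinearMap.range (LinearMap.mulRight ℂ φ)) :=
        Nat.mul_le_mul_left _ (h4.trans h5.le)

end IdealDim

/-! ## Proof of `NoBigSubgroupInQuotient` (test function `1_H`, Vershik–Kerov) -/

section NoBigSubgroup

open MonoidAlgebra
open Summit.MatrixMultiplication.MatrixMultiplication.Theorems.HyperoctahedralThreshold.Negative

/-- **No big subgroup in the quotient set of a member of a near-threshold TPP triple, proved.** -/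
theorem noBigSubgroupInQuotient_holds : NoBigSubgroupInQuotient := by
  intro c ε hc hε hcε
  obtain ⟨n₀, hn₀⟩ := VershikKerov1985_maxCharDegree_holds ε hε
  refine ⟨n₀, fun n hn S T U hT hlarge H hHQ => ?_⟩
  classical
  -- the test function `1_H`
  set SH : Finset (Equiv.Perm (Fin n)) := Finset.univ.filter (· ∈ H) with hSH
  have hSHmem : ∀ x, x ∈ SH ↔ x ∈ H := fun x => by simp [hSH]
  set φ : MonoidAlgebra ℂ (Equiv.Perm (Fin n)) := ∑ h ∈ SH, single h (1 : ℂ) with hφ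
  have hcoeffφ : ∀ g, φ.coeff g = if g ∈ SH then 1 else 0 := fun g => ind_coeff SH g
  have hsupp : ∀ g, φ.coeff g ≠ 0 → g ∈ quotientSet S := by
    intro g hg
    rw [hcoeffφ] at hg
    by_cases h : g ∈ SH
    · exact hHQ g ((hSHmem g).1 h)
    · rw [if_neg h] at hg
      exact absurd rfl hg
  have h1 : φ.coeff 1 ≠ 0 := by
    rw [hcoeffφ, if_pos ((hSHmem 1).2 H.one_mem)]
    exact one_ne_zero
  -- sieve + ideal dimension + `rank (· * 1_H) ≤ [G:H]`
  have hsieve := testFunctionSieve_holds (Equiv.Perm (Fin n)) S T U hT φ hsupp h1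
  have hdim := twoSidedIdealDimBound_holds (Equiv.Perm (Fin n)) φ
  have hrange := finrank_range_mulRight_le H SH hSHmem
  have hTU : T.card * U.card ≤ maxCharDegree (Equiv.Perm (Fin n)) * H.index :=
    hsieve.trans (hdim.trans (Nat.mul_le_mul_left _ hrange))
  have hnat : S.card * T.card * U.card * Nat.card H ≤
      S.card * maxCharDegree (Equiv.Perm (Fin n)) * n.factorial := by
    have hHG : Nat.card H * H.index = n.factorial := by
      rw [Subgroup.card_mul_index, Nat.card_eq_fintype_card, Fintype.card_perm, Fintype.card_fin]
    calc S.card * T.card * U.card * Nat.card H = S.card * ((T.card * U.card) * Nat.card H) := by ring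
      _ ≤ S.card * ((maxCharDegree (Equiv.Perm (Fin n)) * H.index) * Nat.card H) :=
          Nat.mul_le_mul_left _ (Nat.mul_le_mul_right _ hTU)
      _ = S.card * maxCharDegree (Equiv.Perm (Fin n)) * n.factorial := by
          rw [← hHG]; ring
  -- real arithmetic
  have hreal : ((S.card * T.card * U.card : ℕ) : ℝ) * (Nat.card H : ℝ) ≤
      (S.card : ℝ) * (maxCharDegree (Equiv.Perm (Fin n)) : ℝ) * (n.factorial : ℝ) := by
    exact_mod_cast hnat
  have hVK := (hn₀ n hn).2
  set x : ℝ := Real.sqrt (n : ℝ) with hx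
  set F : ℝ := (n.factorial : ℝ) with hF
  have hF0 : 0 < F := by rw [hF]; exact_mod_cast n.factorial_pos
  have hsF0 : 0 < Real.sqrt F := Real.sqrt_pos.2 hF0
  have hpow : F ^ ((3 : ℝ) / 2) = F * Real.sqrt F := by
    rw [show ((3 : ℝ) / 2) = 1 + (1 / 2 : ℝ) by norm_num, Real.rpow_add' hF0.le (by norm_num),
      Real.rpow_one, Real.sqrt_eq_rpow]
  have hh0 : (0 : ℝ) ≤ (Nat.card H : ℝ) := Nat.cast_nonneg _
  have hS0 : (0 : ℝ) ≤ (S.card : ℝ) := Nat.cast_nonneg _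
  -- L · |H| ≤ V · |H| ≤ |S| · d_max · n! ≤ |S| · √(n!) e^{-(c₂-ε)x} · n!
  have hchain : F * Real.sqrt F * Real.exp (-(c * x)) * (Nat.card H : ℝ) ≤
      (S.card : ℝ) * (Real.sqrt F * Real.exp (-((vkUpperConst - ε) * x))) * F := by
    calc F * Real.sqrt F * Real.exp (-(c * x)) * (Nat.card H : ℝ)
        = F ^ ((3 : ℝ) / 2) * Real.exp (-(c * x)) * (Nat.card H : ℝ) := by rw [hpow]
      _ ≤ ((S.card * T.card * U.card : ℕ) : ℝ) * (Nat.card H : ℝ) :=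
          mul_le_mul_of_nonneg_right hlarge hh0
      _ ≤ (S.card : ℝ) * (maxCharDegree (Equiv.Perm (Fin n)) : ℝ) * F := hreal
      _ ≤ (S.card : ℝ) * (Real.sqrt F * Real.exp (-((vkUpperConst - ε) * x))) * F := by
          refine mul_le_mul_of_nonneg_right (mul_le_mul_of_nonneg_left hVK hS0) hF0.le
  -- divide by F √F > 0
  have hkey : Real.exp (-(c * x)) * (Nat.card H : ℝ) ≤
      (S.card : ℝ) * Real.exp (-((vkUpperConst - ε) * x)) := by
    have hFF : 0 < F * Real.sqrt F := mul_pos hF0 hsF0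
    have h' : F * Real.sqrt F * (Real.exp (-(c * x)) * (Nat.card H : ℝ)) ≤
        F * Real.sqrt F * ((S.card : ℝ) * Real.exp (-((vkUpperConst - ε) * x))) := by
      calc F * Real.sqrt F * (Real.exp (-(c * x)) * (Nat.card H : ℝ))
          = F * Real.sqrt F * Real.exp (-(c * x)) * (Nat.card H : ℝ) := by ring
        _ ≤ (S.card : ℝ) * (Real.sqrt F * Real.exp (-((vkUpperConst - ε) * x))) * F := hchain
        _ = F * Real.sqrt F * ((S.card : ℝ) * Real.exp (-((vkUpperConst - ε) * x))) := by ring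
    exact le_of_mul_le_mul_left h' hFF
  -- multiply by e^{c x}
  have e1 : Real.exp (-((vkUpperConst - c - ε) * x)) =
      Real.exp (c * x) * Real.exp (-((vkUpperConst - ε) * x)) := by
    rw [← Real.exp_add]
    congr 1
    ring
  have e2 : (Nat.card H : ℝ) = Real.exp (c * x) * (Real.exp (-(c * x)) * (Nat.card H : ℝ)) := by
    rw [← mul_assoc, ← Real.exp_add, show c * x + -(c * x) = 0 by ring, Real.exp_zero, one_mul]
  rw [e1, e2]
  calc Real.exp (c * x) * (Real.exp (-(c * x)) * (Nat.card H : ℝ))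
      ≤ Real.exp (c * x) * ((S.card : ℝ) * Real.exp (-((vkUpperConst - ε) * x))) :=
        mul_le_mul_of_nonneg_left hkey (Real.exp_pos _).le
    _ = (S.card : ℝ) * (Real.exp (c * x) * Real.exp (-((vkUpperConst - ε) * x))) := by ring

end NoBigSubgroup

end Summit.MatrixMultiplication.MatrixMultiplication.Cruxes.JuntaBranch.Ideator4
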